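import Summits.Ventures.HSemireg.ContractionSpanFourierDualBasis
import HarnessLib

/-!
# Venture HSemireg — the contraction span as an OPERATOR span, its transport under conjugation, and the graded
# Leibniz rules for a left factor `Λf(a)` (all `a`, no homogeneity)

HONEST FRAMING. Pure linear algebra in exterior algebras (Mathlib `ExteriorAlgebra` / `CliffordAlgebra`), written for the
computation cell `pub-hsemireg` (seat p4) over seat p4's abstract contraction span `ContractionSpan.span L Θ x`
(`ContractionSpanAlgebra.lean`). Nothing here is a claim about any variety; nothing here says that HC / HC_CM / HC_AV holds.
Everything is PROVED; no named fact; the only new definitions are the bookkeeping sets `elemOps` / `opSpan`.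
This is part 1 of 3 of the PARTIAL-FOURIER invariance of the polyvector contraction rank (class-level H-FM along ONE
Künneth factor; parts 2–3: `ContractionSpanPartialFourier.lean`, `ContractionSpanPartialFourierRank.lean`), the piece the
tree lacked for a kernel evaluation of the census certificate (I2-β) «`r(𝓔) = 18`» of the g = 4 object
`E₀ = Φ(I_{p×X ∪ X×q})`, whose class `ch(E₀) = −1 − e^{−c₁(𝒫)} + pt_X + pt_X̂` on `A₀ = X × X̂` (cell file
`step0/T4a/README-T4a.md` §2) is the image of the point-pair box `ch(I_p ⊠ I_q)` under the shear `μ^*` and the Fourier–Mukai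
transform ALONG THE SECOND FACTOR (Orlov's `Φ_{X×X→X×X̂} = (id × Φ_𝒫) ∘ μ_*`), and is not itself a box in any splitting.

1. `span_eq_opSpan`: for `Θ` killing `L`, p4's span of `x` is the span of `T₁ (T₂ x)` over `T₁, T₂` in the LINEAR SPAN of
   the elementary operators `elemOps L Θ = {q ∧ · : q ∈ L} ∪ {ι_θ : θ ∈ Θ}` (the fourth family `ι_θ (q ∧ x) = −q ∧ ι_θ x`
   is redundant) — so everything downstream is bilinear in the operators.
2. `map_opSpan_eq_of_conj` / `rank_opSpan_eq_of_conj`: a linear isomorphism `F : Λ V ≅ Λ V'` that conjugates every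
   elementary operator of `(L, Θ)` into the span of those of `(L', Θ')`, and conversely under `F⁻¹`, maps the one operator
   span onto the other; the ranks agree.
3. `ι_mul_map_eq`: `w ∧ Λf(a) = Λf(ã) ∧ w` and `contractLeft_map_mul`: `ι_θ(Λf(a) ∧ y) = Λf(ι_{θ∘f} a) ∧ y + Λf(ã) ∧ ι_θ y`
   (`ã` = grade involution `CliffordAlgebra.involute a`) for a linear map `f : M → N` and EVERY (inhomogeneous) `a ∈ Λ M` —
   the sign bookkeeping that replaces homogeneity arguments (left induction with the CAR relation only).
References: [BourbakiAlgebre1a3] Ch. III §7 no. 1, §11 no. 9; [BuchweitzFlenner2008HH] Prop. 6.4.4 (origin of `r`).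
-/

noncomputable section

open CliffordAlgebra (contractLeft)
open ExteriorAlgebra (ι)
open scoped TensorProduct

namespace Summit.Ventures.HSemireg

namespace ContractionSpan

/-! ### 1. The operator form of the contraction span and its transport under conjugation -/

section OpSpan

universe u v

variable {K : Type u} [Field K] {V : Type v} [AddCommGroup V] [Module K V]

/-- The ELEMENTARY OPERATORS of a contraction datum `(L, Θ)`: left multiplications `q ∧ ·` (`q ∈ L`) and interior
products `ι_θ` (`θ ∈ Θ`), as elements of `End(Λ V)`. [cite: BourbakiAlgebre1a3, Ch. III §11 no. 9] -/
def elemOps (L : Set V) (Θ : Set (Module.Dual K V)) : Set (Module.End K (ExteriorAlgebra K V)) :=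
  {T | ∃ q ∈ L, T = LinearMap.mulLeft K (ι K q)} ∪ {T | ∃ θ ∈ Θ, T = contractLeft θ}

/-- The OPERATOR SPAN of `x`: the span of `T₁ (T₂ x)` over `T₁, T₂` in the linear span of a set `S` of operators.
[cite: BourbakiAlgebre1a3, Ch. III §11 no. 9] -/
def opSpan (S : Set (Module.End K (ExteriorAlgebra K V))) (x : ExteriorAlgebra K V) :
    Submodule K (ExteriorAlgebra K V) :=
  Submodule.span K {y | ∃ T₁ ∈ Submodule.span K S, ∃ T₂ ∈ Submodule.span K S, y = T₁ (T₂ x)}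

/-- `T₁ (T₂ x) ∈ opSpan S x` for `T₁, T₂` in the span of `S`. [cite: BourbakiAlgebre1a3, Ch. III §11 no. 9] -/
theorem apply_apply_mem_opSpan {S : Set (Module.End K (ExteriorAlgebra K V))} {x : ExteriorAlgebra K V}
    {T₁ T₂ : Module.End K (ExteriorAlgebra K V)} (h₁ : T₁ ∈ Submodule.span K S) (h₂ : T₂ ∈ Submodule.span K S) :
    T₁ (T₂ x) ∈ opSpan S x :=
  Submodule.subset_span ⟨T₁, h₁, T₂, h₂, rfl⟩

/-- Every generator `T₁ (T₂ x)` with `T₁, T₂` ELEMENTARY lies in p4's span when `Θ` kills `L` (the family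
`ι_θ (q ∧ x) = −q ∧ ι_θ x` included). [cite: BourbakiAlgebre1a3, Ch. III §11 no. 9] -/
theorem apply_apply_mem_span {L : Set V} {Θ : Set (Module.Dual K V)} (hΘL : ∀ θ ∈ Θ, ∀ q ∈ L, θ q = 0)
    (x : ExteriorAlgebra K V) {T₁ T₂ : Module.End K (ExteriorAlgebra K V)} (h₁ : T₁ ∈ elemOps L Θ)
    (h₂ : T₂ ∈ elemOps L Θ) : T₁ (T₂ x) ∈ span L Θ x := by
  rcases h₁ with ⟨q₁, hq₁, rfl⟩ | ⟨θ₁, hθ₁, rfl⟩ <;> rcases h₂ with ⟨q₂, hq₂, rfl⟩ | ⟨θ₂, hθ₂, rfl⟩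
  · exact Submodule.subset_span (Or.inl (Or.inl ⟨q₁, hq₁, q₂, hq₂, rfl⟩))
  · exact Submodule.subset_span (Or.inl (Or.inr ⟨q₁, hq₁, θ₂, hθ₂, rfl⟩))
  · -- `ι_θ (q ∧ x) = θ(q) x - q ∧ ι_θ x = -(q ∧ ι_θ x)`
    have h : contractLeft θ₁ (LinearMap.mulLeft K (ι K q₂) x) = -(ι K q₂ * contractLeft θ₁ x) := by
      rw [LinearMap.mulLeft_apply, CliffordAlgebra.contractLeft_ι_mul, hΘL θ₁ hθ₁ q₂ hq₂, zero_smul, zero_sub]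
    rw [h]
    exact Submodule.neg_mem _ (Submodule.subset_span (Or.inl (Or.inr ⟨q₂, hq₂, θ₁, hθ₁, rfl⟩)))
  · exact Submodule.subset_span (Or.inr ⟨θ₁, hθ₁, θ₂, hθ₂, rfl⟩)

/-- **p4's span is the operator span of the elementary operators** (for `Θ` killing `L`).
[cite: BourbakiAlgebre1a3, Ch. III §11 no. 9] [cite: BuchweitzFlenner2008HH, Prop. 6.4.4] -/
theorem span_eq_opSpan {L : Set V} {Θ : Set (Module.Dual K V)} (hΘL : ∀ θ ∈ Θ, ∀ q ∈ L, θ q = 0)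
    (x : ExteriorAlgebra K V) : span L Θ x = opSpan (elemOps L Θ) x := by
  apply le_antisymm
  · refine Submodule.span_le.2 ?_
    rintro y ((⟨q₁, hq₁, q₂, hq₂, rfl⟩ | ⟨q, hq, θ, hθ, rfl⟩) | ⟨θ₁, hθ₁, θ₂, hθ₂, rfl⟩)
    · exact apply_apply_mem_opSpan (T₁ := LinearMap.mulLeft K (ι K q₁)) (T₂ := LinearMap.mulLeft K (ι K q₂))
        (Submodule.subset_span (Or.inl ⟨q₁, hq₁, rfl⟩)) (Submodule.subset_span (Or.inl ⟨q₂, hq₂, rfl⟩))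
    · exact apply_apply_mem_opSpan (T₁ := LinearMap.mulLeft K (ι K q)) (T₂ := contractLeft θ)
        (Submodule.subset_span (Or.inl ⟨q, hq, rfl⟩)) (Submodule.subset_span (Or.inr ⟨θ, hθ, rfl⟩))
    · exact apply_apply_mem_opSpan (T₁ := contractLeft θ₁) (T₂ := contractLeft θ₂)
        (Submodule.subset_span (Or.inr ⟨θ₁, hθ₁, rfl⟩)) (Submodule.subset_span (Or.inr ⟨θ₂, hθ₂, rfl⟩))
  · refine Submodule.span_le.2 ?_
    rintro y ⟨T₁, hT₁, T₂, hT₂, rfl⟩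
    -- bilinear in `(T₁, T₂)`: reduce to elementary operators
    induction hT₁ using Submodule.span_induction generalizing T₂ with
    | mem T₁ hT₁ =>
      induction hT₂ using Submodule.span_induction with
      | mem T₂ hT₂ => exact apply_apply_mem_span hΘL x hT₁ hT₂
      | zero => rw [LinearMap.zero_apply, map_zero]; exact Submodule.zero_mem _
      | add T T' _ _ h h' => rw [LinearMap.add_apply, map_add]; exact Submodule.add_mem _ h h'
      | smul a T _ h => rw [LinearMap.smul_apply, map_smul]; exact Submodule.smul_mem _ a h
    | zero => rw [LinearMap.zero_apply]; exact Submodule.zero_mem _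
    | add T T' _ _ h h' => rw [LinearMap.add_apply]; exact Submodule.add_mem _ (h T₂ hT₂) (h' T₂ hT₂)
    | smul a T _ h => rw [LinearMap.smul_apply]; exact Submodule.smul_mem _ a (h T₂ hT₂)

variable {V' : Type v} [AddCommGroup V'] [Module K V']

/-- Conjugation by a linear isomorphism maps the span of `S` into the span of `S'` as soon as it maps `S` there.
[cite: BourbakiAlgebre1a3, Ch. II §1] -/
theorem conj_mem_span_of_forall {S : Set (Module.End K (ExteriorAlgebra K V))}
    {S' : Set (Module.End K (ExteriorAlgebra K V'))} (F : ExteriorAlgebra K V ≃ₗ[K] ExteriorAlgebra K V')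
    (hS : ∀ T ∈ S, F.conj T ∈ Submodule.span K S') {T : Module.End K (ExteriorAlgebra K V)}
    (hT : T ∈ Submodule.span K S) : F.conj T ∈ Submodule.span K S' := by
  induction hT using Submodule.span_induction with
  | mem T hT => exact hS T hT
  | zero => rw [map_zero]; exact Submodule.zero_mem _
  | add T T' _ _ h h' => rw [map_add]; exact Submodule.add_mem _ h h'
  | smul a T _ h => rw [map_smul]; exact Submodule.smul_mem _ a h

/-- **TRANSPORT of the operator span under conjugation**: if `F : Λ V ≅ Λ V'` conjugates every operator of `S` into the
span of `S'` and `F⁻¹` every operator of `S'` into the span of `S`, then `F (opSpan S x) = opSpan S' (F x)`.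
[cite: BourbakiAlgebre1a3, Ch. III §11 no. 9] -/
theorem map_opSpan_eq_of_conj {S : Set (Module.End K (ExteriorAlgebra K V))}
    {S' : Set (Module.End K (ExteriorAlgebra K V'))} (F : ExteriorAlgebra K V ≃ₗ[K] ExteriorAlgebra K V')
    (hS : ∀ T ∈ S, F.conj T ∈ Submodule.span K S') (hS' : ∀ T' ∈ S', F.symm.conj T' ∈ Submodule.span K S)
    (x : ExteriorAlgebra K V) : (opSpan S x).map F.toLinearMap = opSpan S' (F x) := by
  apply le_antisymm
  · rw [Submodule.map_le_iff_le_comap]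
    refine Submodule.span_le.2 ?_
    rintro y ⟨T₁, hT₁, T₂, hT₂, rfl⟩
    change F (T₁ (T₂ x)) ∈ opSpan S' (F x)
    have h : F (T₁ (T₂ x)) = (F.conj T₁) ((F.conj T₂) (F x)) := by
      rw [LinearEquiv.conj_apply_apply, LinearEquiv.conj_apply_apply, LinearEquiv.symm_apply_apply,
        LinearEquiv.symm_apply_apply]
    rw [h]
    exact apply_apply_mem_opSpan (conj_mem_span_of_forall F hS hT₁) (conj_mem_span_of_forall F hS hT₂)
  · refine Submodule.span_le.2 ?_
    rintro y ⟨T₁, hT₁, T₂, hT₂, rfl⟩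
    refine ⟨(F.symm.conj T₁) ((F.symm.conj T₂) x), ?_, ?_⟩
    · exact apply_apply_mem_opSpan (conj_mem_span_of_forall F.symm hS' hT₁) (conj_mem_span_of_forall F.symm hS' hT₂)
    · rw [LinearEquiv.coe_coe, LinearEquiv.conj_apply_apply, LinearEquiv.conj_apply_apply, LinearEquiv.symm_symm,
        LinearEquiv.apply_symm_apply, LinearEquiv.apply_symm_apply]

/-- … hence the operator spans have the same rank. [cite: BourbakiAlgebre1a3, Ch. III §11 no. 9] -/
theorem rank_opSpan_eq_of_conj {S : Set (Module.End K (ExteriorAlgebra K V))}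
    {S' : Set (Module.End K (ExteriorAlgebra K V'))} (F : ExteriorAlgebra K V ≃ₗ[K] ExteriorAlgebra K V')
    (hS : ∀ T ∈ S, F.conj T ∈ Submodule.span K S') (hS' : ∀ T' ∈ S', F.symm.conj T' ∈ Submodule.span K S)
    (x : ExteriorAlgebra K V) : Module.rank K (opSpan S x) = Module.rank K (opSpan S' (F x)) := by
  rw [← map_opSpan_eq_of_conj F hS hS' x]
  exact (Submodule.equivMapOfInjective F.toLinearMap F.injective (opSpan S x)).rank_eq

end OpSpan

/-! ### 2. Graded Leibniz rules for a left factor coming from a linear map `f : M → N` (all `a`, no homogeneity) -/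

section Leibniz

variable {K : Type*} [Field K] {M N : Type*} [AddCommGroup M] [Module K M] [AddCommGroup N] [Module K N]

/-- **`w ∧ Λf(a) = Λf(ã) ∧ w`** (`ã = involute a`, the grade involution): a `1`-vector passes a factor at the cost of the
grade involution — for EVERY (inhomogeneous) `a`. [cite: BourbakiAlgebre1a3, Ch. III §7 no. 1] -/
theorem ι_mul_map_eq (f : M →ₗ[K] N) (w : N) (a : ExteriorAlgebra K M) :
    ι K w * ExteriorAlgebra.map f a = ExteriorAlgebra.map f (CliffordAlgebra.involute a) * ι K w := by
  induction a using CliffordAlgebra.left_induction with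
  | algebraMap r =>
    rw [AlgHom.commutes, AlgHom.commutes, AlgHom.commutes, Algebra.commutes]
  | add x y hx hy => rw [map_add, map_add, map_add, mul_add, add_mul, hx, hy]
  | ι_mul x m hx =>
    calc ι K w * ExteriorAlgebra.map f (ι K m * x)
        = ι K w * ι K (f m) * ExteriorAlgebra.map f x := by
          rw [map_mul (ExteriorAlgebra.map f), ExteriorAlgebra.map_apply_ι, mul_assoc]
      _ = -(ι K (f m) * (ι K w * ExteriorAlgebra.map f x)) := by rw [ι_mul_ι_eq_neg, neg_mul, mul_assoc]
      _ = -(ι K (f m) * (ExteriorAlgebra.map f (CliffordAlgebra.involute x) * ι K w)) := by rw [hx]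
      _ = ExteriorAlgebra.map f (CliffordAlgebra.involute (ι K m * x)) * ι K w := by
          rw [map_mul CliffordAlgebra.involute, involute_ι', neg_mul, map_neg (ExteriorAlgebra.map f),
            map_mul (ExteriorAlgebra.map f), ExteriorAlgebra.map_apply_ι, neg_mul, mul_assoc]

/-- **Graded Leibniz rule for a left factor `Λf(a)`**: `ι_θ(Λf(a) ∧ y) = Λf(ι_{θ∘f} a) ∧ y + Λf(ã) ∧ ι_θ y`, for EVERY
`a` (left induction on `a` with the CAR relation `ι_θ(m ∧ z) = θ(m) z − m ∧ ι_θ z`).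
[cite: BourbakiAlgebre1a3, Ch. III §11 no. 9] -/
theorem contractLeft_map_mul (f : M →ₗ[K] N) (θ : Module.Dual K N) (a : ExteriorAlgebra K M) (y : ExteriorAlgebra K N) :
    contractLeft θ (ExteriorAlgebra.map f a * y) =
      ExteriorAlgebra.map f (contractLeft (θ ∘ₗ f) a) * y +
        ExteriorAlgebra.map f (CliffordAlgebra.involute a) * contractLeft θ y := by
  induction a using CliffordAlgebra.left_induction generalizing y with
  | algebraMap r =>
    rw [AlgHom.commutes, CliffordAlgebra.contractLeft_algebraMap, map_zero, zero_mul, zero_add, AlgHom.commutes,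
      AlgHom.commutes, CliffordAlgebra.contractLeft_algebraMap_mul]
  | add x x' hx hx' =>
    rw [map_add, add_mul, map_add, hx, hx', map_add, map_add, map_add, map_add, add_mul, add_mul]; abel
  | ι_mul x m hx =>
    calc contractLeft θ (ExteriorAlgebra.map f (ι K m * x) * y)
        = contractLeft θ (ι K (f m) * (ExteriorAlgebra.map f x * y)) := by
          rw [map_mul (ExteriorAlgebra.map f), ExteriorAlgebra.map_apply_ι, mul_assoc]
      _ = θ (f m) • (ExteriorAlgebra.map f x * y) - ι K (f m) * (ExteriorAlgebra.map f (contractLeft (θ ∘ₗ f) x) * y +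
            ExteriorAlgebra.map f (CliffordAlgebra.involute x) * contractLeft θ y) := by
          rw [CliffordAlgebra.contractLeft_ι_mul, hx]
      _ = ExteriorAlgebra.map f (contractLeft (θ ∘ₗ f) (ι K m * x)) * y +
            ExteriorAlgebra.map f (CliffordAlgebra.involute (ι K m * x)) * contractLeft θ y := by
          rw [CliffordAlgebra.contractLeft_ι_mul, LinearMap.comp_apply, map_sub (ExteriorAlgebra.map f),
            map_smul (ExteriorAlgebra.map f), map_mul (ExteriorAlgebra.map f), ExteriorAlgebra.map_apply_ι,
            map_mul CliffordAlgebra.involute, involute_ι', neg_mul, map_neg (ExteriorAlgebra.map f),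
            map_mul (ExteriorAlgebra.map f), ExteriorAlgebra.map_apply_ι, sub_mul, smul_mul_assoc, neg_mul, mul_add,
            mul_assoc, mul_assoc]
          abel

/-- Special case: if `θ` kills the image of `f`, then `ι_θ(Λf(a) ∧ y) = Λf(ã) ∧ ι_θ y`.
[cite: BourbakiAlgebre1a3, Ch. III §11 no. 9] -/
theorem contractLeft_map_mul_of_comp_eq_zero (f : M →ₗ[K] N) {θ : Module.Dual K N} (hθ : θ ∘ₗ f = 0)
    (a : ExteriorAlgebra K M) (y : ExteriorAlgebra K N) :
    contractLeft θ (ExteriorAlgebra.map f a * y) = ExteriorAlgebra.map f (CliffordAlgebra.involute a) * contractLeft θ y := by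
  rw [contractLeft_map_mul, hθ, map_zero, LinearMap.zero_apply, map_zero, zero_mul, zero_add]

end Leibniz

end ContractionSpan

end Summit.Ventures.HSemireg

end
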